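import Mathlib
import HarnessLib
import HarnessLib.Audit
import Summits.Langlands.Statement
import Summits.Langlands.Langlands.Theses.EllipticDegreeLadder
import Summits.Langlands.Langlands.Theses.QuinticX0105Split

/-!
# `QuinticX0105Split` — decomp-langlands lens-5 (finite/base range + asymptotic regime + bridge), generation 17

TARGET (host decl, BY NAME): Q5 = `Summit.Langlands.Langlands.Theses.EllipticDegreeLadder.QuinticModularity`
(stmt-Langlands-30187, crux rank 3, OPEN, never split; route-Langlands-EllipticDegreeLadder rev 4 — the lens-1-g7
degree ladder on R2 = `PrimitiveRankLadder.RankTwoPrimitiveAutomorphy` 24803; Q5 is the binder `hQuint` of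
`EllipticDegreeLadder.closes`).  Q5: every elliptic curve E (integral model, Δ ≠ 0) over every TOTALLY REAL QUINTIC
number field K is modular in the tree's sense (E_K has CM, or a weight-zero cuspidal π on GL₂/K whose Satake sums
give a_w(E)/√q_w at almost all w).  Print: Ishitsuka–Ito–Yoshikawa 2022 (IIY) Thm 1.2 — true outside a finite,
INEFFECTIVE list of pairs (F_i, j = α_i) [corpus:paper-arxiv-2110.04078 p3; Rem 1.4 p4 «not effective because the
proof relies on a theorem of Faltings»].

THE CUT (the lens read on IIY's own proof: asymptotic/generic regime = the switching primes 3–5–7 do their work;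
finite range = the exceptional locus, which the literature treats as ONE ineffective finite set but which in fact
SPLITS BY EFFECTIVITY; bridge = an effective degree-5 point-determination):

* GQM `GenericQuinticModularity` (crux · PRINT · ATTACKABLE-NOW): Q5's text VERBATIM with ONE inserted hypothesis
  «E is NOT (3,5,7)-exceptional», i.e. NOT [mod-3 image Borel-or-C_s⁺(3) in some framing ∧ mod-5 image Borel in
  some framing ∧ mod-7 image Borel-or-G(e7) in some framing].  IN PRINT for every totally real K with √5 ∉ K and
  K ∩ ℚ(ζ₇) = ℚ — automatic for [K:ℚ] = 5 — as Box 2022 Thm 1.3 [corpus:paper-arxiv-2103.13975 p4: «E non-modular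
  ⇒ (i) Im ρ̄_{E,3} ⊂ C_s⁺(3) or B(3); (ii) √5 ∉ K ⇒ Im ρ̄_{E,5} ⊂ B(5); (iii) K ∩ ℚ(ζ₇) = ℚ ⇒ Im ρ̄_{E,7} ⊂ B(7) or
  G(e7)»] = Freitas–Le Hung–Siksek 2015 Thms 3–4 + Rubin (p = 3) + Thorne 2016 (p = 5) + Kalyanswamy 2018 / FLS (p = 7)
  [corpus:paper-arxiv-2110.04078 p5].  The framing predicates are BYTE-COPIES of the live sibling's
  (`SqrtFiveQuarticCovers.BoxBorelFive` 17835 / `ReductionToRefinedLocus` 17834, degree 4 with √5 ∈ K), so one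
  vendoring of the printed image theorems serves both routes.  Strictly weaker than Q5: it is a theorem in print,
  Q5 is not.
* XM `QuinticX0105Modularity` (crux · the FINITE EFFECTIVE RANGE · INSTRUMENTABLE/DECIDABLE): Q5 VERBATIM with ONE
  inserted hypothesis «mod-3, mod-5 and mod-7 images all Borel in some framing» (E has K-rational 3-, 5- and
  7-isogenies: E is a non-cuspidal K-point of X(b3,b5,b7) = X₀(105), genus 13).  EFFECTIVE: J₀(105)(ℚ) is FINITE
  (all six newform classes of level ∣ 105 have analytic rank 0 — IIY Lemma 5.3(3), App. 6.3 [corpus:paper-arxiv-2110.04078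
  p10, p14]; Derickx–Hwang–Jeon–Orlić 2025 Prop 4.1 [corpus:paper-arxiv-2503.08975 p9]) and X₀(105) has ℚ- and
  ℂ-gonality 6 (IIY Prop 5.5), so by IIY Thm 3.3 the quintic points INJECT into the finite torsion group
  J₀(105)(ℚ) (x ↦ [D_x − 5∞]) — a finite, decidable enumeration (torsion of J₀(105) by cuspidal subgroup + Hecke
  bounds; Riemann–Roch on Box's genus-13 model in each torsion class), followed by per-point certificates (CM, or
  j ∈ ℚ ⇒ modular by base change + quadratic twist).  Nobody has run it: IIY Rem 1.4 files all four curves under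
  Faltings.  Strictly weaker than Q5 (it says nothing off X₀(105)).
* CLM `QuinticCartanLocusModularity` (declared RESIDUAL · IDEA-NEEDED · INSTRUMENTABLE-heavy): Q5 VERBATIM with ONE
  inserted hypothesis «(3,5,7)-exceptional AND NOT (mod-3 Borel ∧ mod-7 Borel)» — the K-points of X(s3,b5,b7)
  (genus 21, rk J(ℚ) = 2 from 315.2.a.c), X(b3,b5,e7) (genus 73; IIY work on X(b3,b5,ns7)/w₃, genus 19, rk 8) and
  X(s3,b5,e7) (genus 153) that are NOT on X₀(105) [corpus:paper-arxiv-2110.04078 p11, p14–15].  Finite only through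
  Faltings (IIY Thm 3.4 via Abramovich–Harris; Abramovich–Frey gonality ≥ 15 for the last curve) — the honest
  ineffective core of Q5.  BRIDGE named: degree-5 (relative) symmetric Chabauty + Mordell–Weil sieve (Siksek;
  Box–Gajović–Goodman) — its rank condition r + d ≤ g HOLDS for the two middle curves (2 + 5 ≤ 21, 8 + 5 ≤ 19), so
  the residual is instrumentable in principle; for genus 153 only through its maps to smaller curves.  Strictly
  weaker than Q5 on paper; modulo GQM (print) and XM (a finite computation) it IS the open content of Q5 — declared
  residual, never dressed as progress.

KERNEL (0 EQUIV, pure propositional logic, no case analysis on the long predicates): `Cert.q5_iff_cells :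
Q5 ↔ GQM ∧ XM ∧ CLM`.  ⇒: each cell is Q5 with an extra hypothesis.  ⇐: for E over K, if E is modular we are done;
else GQM forces E exceptional, CLM forces (b3 ∧ b7), and XM (with b5 from exceptionality) makes E modular —
contradiction (`Cert.q5_of_cells`, a chain of three `byContradiction`s).

ORBIT CLOSURE (HOME/NOTES.md orbit rule; critic row 269 o1): the print transfer groupoid of Q5's objects (E/K, K
quintic totally real) is generated by K-isogenies, quadratic twists and field isomorphisms (K has no proper subfield
≠ ℚ, so no in-box base change / restriction).  Every cell is a union of orbits: (i) −I ∈ B(p), −I ∈ C_s⁺(3)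
(= abab for the printed generators a = diag(1,2), b = antidiag(1,1)) and −I ∈ G(e7) (= g₁g₂g₁g₂g₁g₂g₁g₂g₂g₂ for the
printed generators; indeed every scalar lies in G(e7)), so a quadratic twist ρ̄ ⊗ χ̄ keeps each framing condition;
(ii) an isogeny of degree prime to p leaves ρ̄_p unchanged, and a K-rational p-isogeny exists only on the Borel
locus bp, whose image under it is again bp (dual isogeny) — so «exceptional», «b3 ∧ b5 ∧ b7» and «exceptional ∧
¬(b3 ∧ b7)» are isogeny-invariant; (iii) transport along K ≅ K' is tautological.  Hence no object of the residual
CLM is print-equivalent to an object of XM or of the generic cell: NO LEAK.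

WHY THIS IS NOVEL (cell-relative and literature-relative): the cell's only cut of the elliptic sector is lens-1's
DEGREE ladder (≤ 3 | 4 | 5 | off-ladder) and, inside degree 4, SqrtFive's 5-IMAGE cut (b5 | H8/H12 for √5 ∈ K);
this node cuts the degree-5 rung by EFFECTIVITY OF THE FINITENESS MECHANISM — rank-0 Jacobian (X₀(105): torsion
injection, decidable) versus positive-rank Jacobians (Faltings) — an axis nobody on the bus has used, and one the
literature itself blurs (IIY Rem 1.4 declares the whole exceptional list ineffective although their own Lemma
5.3(3) + Thm 3.3 make the X₀(105) part effective).  Nearest prior art: Box 2022 Thm 1.5 (ALL quartic points of the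
same four curves; X₀(105) via ten quotients), DHJO 2025 Prop 4.1 (finiteness of quintic points on X₀(105), no
determination), IIY 2022 (finiteness on all four, ineffective by declaration).  Differs from every lens-5
predecessor (g0–g15: dials on the lifting prime / residual image size / adequacy; g16: cofinite-in-λ irreducibility):
first use of the lens on the arithmetic-geometry side (points on modular curves), and the first node whose finite
range is DECIDABLE AS TYPED.

DECIDING THEOREMS: `closes : GQM → XM → CLM → Q5` (conclusion = the host decl BY NAME; 3/3 binders used);
`closes_root` = `EllipticDegreeLadder.closes` with its binder `hQuint` produced by `closes` (14 binders →
`_root_.Langlands`).  NECESSITY: `Cert.gqm_of_q5`, `Cert.xm_of_q5`, `Cert.clm_of_q5` (each cell WEAKER than Q5).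
ROOT-NECESSITY: in-tree UNDECIDED, inherited verbatim from Q5 (host TAGS, crit row 68: the ∞-gap `IsLAlgebraic` vs
`HasWeightZero` between the summit's π and the elliptic rendering) — on paper every cell is implied by Langlands.
Tags: GQM WEAKER·crux·PRINT/ATTACKABLE-NOW · XM WEAKER·crux·FINITE-DECIDABLE/INSTRUMENTABLE · CLM WEAKER·DECLARED
RESIDUAL·IDEA-NEEDED (effective degree-5 Chabauty) / INSTRUMENTABLE-heavy; catalogued barrier in play:
ResiduallyReducibleBarrier (the whole exceptional locus is residually reducible at 5 — evaded as in SqrtFive: the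
small-image curves are ENUMERATED as points, never lifted).

CENSUS TWIN (census-1 g25, landing of the lens's (T) offer): the route is BORN (79th cell route, route-Langlands-QuinticX0105Split rev 0
@8b9e2b506feb; items GQM stmt-Langlands-27794 · XM 27795 · CLM 27796 · Assembly 27797 CLOSED by `Theorems/QuinticX0105SplitAssembly.lean`), so the three
cells are NOT re-declared here: every kernel refers to the BORN ROUTE DECLS BY NAME (`open Summit.Langlands.Langlands.Theses.QuinticX0105Split (…)`);
the node's `closes`/`closes_root` are renamed `q5_of_cells'`/`root_of_cells` (a helper may not declare `closes`).  `--supports stmt-Langlands-30187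
--as helper`.  Nothing here proves `Langlands` or Q5.
-/

set_option linter.dupNamespace false -- project-wide: `Summit.Langlands.Langlands` is the mandated namespace

namespace Summit.Langlands.Langlands.Theorems.QuinticX0105Split

open Summit.Langlands.Langlands.Theses.QuinticX0105Split (GenericQuinticModularity QuinticX0105Modularity
  QuinticCartanLocusModularity)

open scoped BigOperators Topology Manifold Classical MeasureTheory ProbabilityTheory Matrix InnerProductSpace ComplexConjugate ContinuousMap
open Filter Set Function TopologicalSpace MeasureTheory
open Summit.Langlands.Langlands.Theses

/-! ## §1 The three cells (host text of Q5 30187 VERBATIM with ONE inserted hypothesis each, inserted after `E.Δ ≠ 0 →`;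
the mod-p framing predicates are byte-copies of `SqrtFiveQuarticCovers.BoxBorelFive` / `ReductionToRefinedLocus`:
«ρ is the mod-p representation of E in some framing» = a ℤ/p-linear isomorphism e : E[p](K̄) ≃ (ℤ/p)² with
e(σ•P) = ρ(σ)·e(P); Borel = lower-left entry 0; C_s⁺(3) = ⟨diag(1,2), antidiag(1,1)⟩; G(e7) = ⟨(0 5;3 0), (5 0;3 2)⟩.) -/




/-! ## §2 Identity of the host decl (read BY NAME from EllipticDegreeLadder rev 4; `Iff.rfl` pins the text this node cut) -/

namespace Cert

/-- Q5 30187 is, by `Iff.rfl`, the text this node cut (Theses/EllipticDegreeLadder.lean :536). -/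
theorem q5_text : EllipticDegreeLadder.QuinticModularity ↔
    (∀ (K : Type) [Field K] [NumberField K], NumberField.IsTotallyReal K → Module.finrank ℚ K = 5 → ∀ E : WeierstrassCurve (NumberField.RingOfIntegers K), E.Δ ≠ 0 → ((E.baseChange K).HasCM ∨ ∃ (hF : Literature.NumberTheory.Automorphic.isCompact_glFiniteIntegralLevel 2 K) (π : Literature.NumberTheory.Automorphic.CuspidalAutomorphicRepData 2 K hF), π.1.HasWeightZero ∧ ∀ᶠ w : IsDedekindDomain.HeightOneSpectrum (NumberField.RingOfIntegers K) in Filter.cofinite, ∃ α : Multiset ℂ, π.1.HasSatakeParamAt w α ∧ ((Real.sqrt w.residueCard : ℝ) : ℂ) * α.sum = (Literature.NumberTheory.Automorphic.frobTraceAt E w : ℂ))) := Iff.rfl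

/-- Q5 is the degree-5 instance of the matrix of the live quartic item: `EllipticDegreeLadder.QuarticModularity`
(= `SqrtFiveQuarticCovers.Target` 17832, dedup-shared) with `= 4` replaced by `= 5` — recorded, by `Iff.rfl`, on the
host's own re-declaration. -/
theorem q4_text : EllipticDegreeLadder.QuarticModularity ↔
    (∀ (K : Type) [Field K] [NumberField K], NumberField.IsTotallyReal K → Module.finrank ℚ K = 4 → ∀ E : WeierstrassCurve (NumberField.RingOfIntegers K), E.Δ ≠ 0 → ((E.baseChange K).HasCM ∨ ∃ (hF : Literature.NumberTheory.Automorphic.isCompact_glFiniteIntegralLevel 2 K) (π : Literature.NumberTheory.Automorphic.CuspidalAutomorphicRepData 2 K hF), π.1.HasWeightZero ∧ ∀ᶠ w : IsDedekindDomain.HeightOneSpectrum (NumberField.RingOfIntegers K) in Filter.cofinite, ∃ α : Multiset ℂ, π.1.HasSatakeParamAt w α ∧ ((Real.sqrt w.residueCard : ℝ) : ℂ) * α.sum = (Literature.NumberTheory.Automorphic.frobTraceAt E w : ℂ))) := Iff.rfl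

/-! ## §3 Kernel: Q5 ⟺ GQM ∧ XM ∧ CLM — pure logic, 0 EQUIV -/

/-- Necessity: Q5 ⇒ GQM (drop the inserted hypothesis). -/
theorem gqm_of_q5 (h : EllipticDegreeLadder.QuinticModularity) : GenericQuinticModularity := by
  intro K _ _ hK hd E hE _
  exact h K hK hd E hE

/-- Necessity: Q5 ⇒ XM. -/
theorem xm_of_q5 (h : EllipticDegreeLadder.QuinticModularity) : QuinticX0105Modularity := by
  intro K _ _ hK hd E hE _
  exact h K hK hd E hE

/-- Necessity: Q5 ⇒ CLM. -/
theorem clm_of_q5 (h : EllipticDegreeLadder.QuinticModularity) : QuinticCartanLocusModularity := by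
  intro K _ _ hK hd E hE _
  exact h K hK hd E hE

/-- Sufficiency: GQM ∧ XM ∧ CLM ⇒ Q5.  If E were not modular: GQM makes it (3,5,7)-exceptional, CLM then forces
mod-3 and mod-7 Borel framings, and XM (mod-5 Borel comes with exceptionality) makes it modular — contradiction.
No predicate is restated: three nested `byContradiction`s. -/
theorem q5_of_cells (hG : GenericQuinticModularity) (hX : QuinticX0105Modularity)
    (hC : QuinticCartanLocusModularity) : EllipticDegreeLadder.QuinticModularity := by
  intro K _ _ hK hd E hE
  refine Classical.byContradiction fun hne => ?_
  refine hne (hG K hK hd E hE fun hx => ?_)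
  refine hne (hC K hK hd E hE ⟨hx, fun hb => ?_⟩)
  exact hne (hX K hK hd E hE ⟨hb.1, hx.2.1, hb.2⟩)

/-- THE EXACT REDUCTION (0 EQUIV): Q5 is equivalent to the conjunction of its three cells. -/
theorem q5_iff_cells : EllipticDegreeLadder.QuinticModularity ↔
    (GenericQuinticModularity ∧ QuinticX0105Modularity ∧ QuinticCartanLocusModularity) :=
  ⟨fun h => ⟨gqm_of_q5 h, xm_of_q5 h, clm_of_q5 h⟩, fun h => q5_of_cells h.1 h.2.1 h.2.2⟩

/-- Non-redundancy bookkeeping (kernel side): the exceptional cell alone with the generic cell rebuilds Q5 exactly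
when XM and CLM are merged — i.e. the node's finer cut loses nothing: (XM ∧ CLM) is equivalent to the single
«exceptional ⇒ modular» cell.  Stated as the two halves provers may want. -/
theorem exceptional_of_xm_clm (hX : QuinticX0105Modularity) (hC : QuinticCartanLocusModularity) :
    ∀ (K : Type) [Field K] [NumberField K], NumberField.IsTotallyReal K → Module.finrank ℚ K = 5 → ∀ E : WeierstrassCurve (NumberField.RingOfIntegers K), E.Δ ≠ 0 → ((∃ ρ : Literature.NumberTheory.GaloisRepresentations.FramedGaloisRep K (ZMod 3) 2, (∃ e : (E.baseChange K).geomTorsion ((3 : ℕ) : ℤ) ≃+ (Fin 2 → ZMod 3), ∀ (σ : Field.absoluteGaloisGroup K) (P : (E.baseChange K).geomTorsion ((3 : ℕ) : ℤ)), e (σ • P) = ((ρ σ : GL (Fin 2) (ZMod 3)) : Matrix (Fin 2) (Fin 2) (ZMod 3)) *ᵥ (e P)) ∧ ((∀ σ : Field.absoluteGaloisGroup K, (((ρ σ : GL (Fin 2) (ZMod 3)) : Matrix (Fin 2) (Fin 2) (ZMod 3)) 1 0 = 0)) ∨ (∀ σ : Field.absoluteGaloisGroup K, (ρ σ : GL (Fin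 2) (ZMod 3)) ∈ Subgroup.closure ({(⟨!![1, 0; 0, 2], !![1, 0; 0, 2], by decide, by decide⟩ : GL (Fin 2) (ZMod 3)), (⟨!![0, 1; 1, 0], !![0, 1; 1, 0], by decide, by decide⟩ : GL (Fin 2) (ZMod 3))} : Set (GL (Fin 2) (ZMod 3)))))) ∧ (∃ ρ : Literature.NumberTheory.GaloisRepresentations.FramedGaloisRep K (ZMod 5) 2, (∃ e : (E.baseChange K).geomTorsion ((5 : ℕ) : ℤ) ≃+ (Fin 2 → ZMod 5), ∀ (σ : Field.absoluteGaloisGroup K) (P : (E.baseChange K).geomTorsion ((5 : ℕ) : ℤ)), e (σ • P) = ((ρ σ : GL (Fin 2) (ZMod 5)) : Matrix (Fin 2) (Fin 2) (ZMod 5)) *ᵥ (e P)) ∧ (∀ σ : Field.absoluteGaloisGroup K, (((ρ σ : GL (Fin 2) (ZMod 5)) : Matrix (Fin 2) (Fin 2) (ZMod 5)) 1 0 = 0))) ∧ (∃ ρ : Literature.NumberTheory.GaloisRepresentations.FramedGaloisRep K (ZMod 7) 2, (∃ e : (E.baseChange K).geomTorsion ((7 : ℕ) : ℤ) ≃+ (Fin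 2 → ZMod 7), ∀ (σ : Field.absoluteGaloisGroup K) (P : (E.baseChange K).geomTorsion ((7 : ℕ) : ℤ)), e (σ • P) = ((ρ σ : GL (Fin 2) (ZMod 7)) : Matrix (Fin 2) (Fin 2) (ZMod 7)) *ᵥ (e P)) ∧ ((∀ σ : Field.absoluteGaloisGroup K, (((ρ σ : GL (Fin 2) (ZMod 7)) : Matrix (Fin 2) (Fin 2) (ZMod 7)) 1 0 = 0)) ∨ (∀ σ : Field.absoluteGaloisGroup K, (ρ σ : GL (Fin 2) (ZMod 7)) ∈ Subgroup.closure ({(⟨!![0, 5; 3, 0], !![0, 5; 3, 0], by decide, by decide⟩ : GL (Fin 2) (ZMod 7)), (⟨!![5, 0; 3, 2], !![3, 0; 6, 4], by decide, by decide⟩ : GL (Fin 2) (ZMod 7))} : Set (GL (Fin 2) (ZMod 7))))))) → ((E.baseChange K).HasCM ∨ ∃ (hF : Literature.NumberTheory.Automorphic.isCompact_glFiniteIntegralLevel 2 K) (π : Literature.NumberTheory.Automorphic.CuspidalAutomorphicRepData 2 K hF), π.1.HasWeightZero ∧ ∀ᶠ w : IsDedekindDomain.HeightOneSpectrum (NumberField.RingOfIntegers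 K) in Filter.cofinite, ∃ α : Multiset ℂ, π.1.HasSatakeParamAt w α ∧ ((Real.sqrt w.residueCard : ℝ) : ℂ) * α.sum = (Literature.NumberTheory.Automorphic.frobTraceAt E w : ℂ)) := by
  intro K _ _ hK hd E hE hx
  refine Classical.byContradiction fun hne => ?_
  refine hne (hC K hK hd E hE ⟨hx, fun hb => ?_⟩)
  exact hne (hX K hK hd E hE ⟨hb.1, hx.2.1, hb.2⟩)

end Cert

/-! ## §4 Deciding theorems -/

/-- `closes` — the node's deciding theorem: the three cells imply the TARGET Q5 =
`EllipticDegreeLadder.QuinticModularity` BY NAME; all three binders are used. -/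
theorem q5_of_cells' (hG : GenericQuinticModularity) (hX : QuinticX0105Modularity)
    (hC : QuinticCartanLocusModularity) : EllipticDegreeLadder.QuinticModularity :=
  Cert.q5_of_cells hG hX hC

/-- Through the host frame: `EllipticDegreeLadder.closes` with its binder `hQuint` produced by `closes` — the other
eleven binders are EllipticDegreeLadder's own items BY NAME (OFF 30186, Q4 17832, Q≤3 30188, TR 30189, R1 24805,
R3p 24804, AI 24806, W⁺ 17415, P 17534, L∤R 18084, CRD 17930). -/
theorem root_of_cells (hOff : EllipticDegreeLadder.OffLadderRankTwoAutomorphy) (hG : GenericQuinticModularity)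
    (hX : QuinticX0105Modularity) (hC : QuinticCartanLocusModularity)
    (hQuart : EllipticDegreeLadder.QuarticModularity) (hSub : EllipticDegreeLadder.SubquarticModularity)
    (hTr : EllipticDegreeLadder.EllipticTransport) (h1 : EllipticDegreeLadder.RankOneAutomorphy)
    (h3 : EllipticDegreeLadder.HigherRankPrimitiveAutomorphy) (hT : EllipticDegreeLadder.CyclicInductionTransport)
    (hW : EllipticDegreeLadder.SatakeAvatarExistence) (hP : EllipticDegreeLadder.PadicMemberCompatibility)
    (hA : EllipticDegreeLadder.CompatibilityAwayFromLR) (hR : EllipticDegreeLadder.CanonicalReciprocityData) :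
    _root_.Langlands :=
  EllipticDegreeLadder.closes hOff (q5_of_cells' hG hX hC) hQuart hSub hTr h1 h3 hT hW hP hA hR

/-! ## §5 Group-theoretic certificates behind the orbit-closure claim (kernel-checked): −I lies in each printed level
subgroup, so quadratic twists preserve every cell. -/

/-- −I ∈ C_s⁺(3) = ⟨diag(1,2), antidiag(1,1)⟩ (word abab). -/
theorem negOne_mem_splitCartanNormalizer_three :
    ((⟨!![2, 0; 0, 2], !![2, 0; 0, 2], by decide, by decide⟩ : GL (Fin 2) (ZMod 3))) ∈
      Subgroup.closure ({(⟨!![1, 0; 0, 2], !![1, 0; 0, 2], by decide, by decide⟩ : GL (Fin 2) (ZMod 3)), (⟨!![0, 1; 1, 0], !![0, 1; 1, 0], by decide, by decide⟩ : GL (Fin 2) (ZMod 3))} : Set (GL (Fin 2) (ZMod 3))) := by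
  set a : GL (Fin 2) (ZMod 3) := ⟨!![1, 0; 0, 2], !![1, 0; 0, 2], by decide, by decide⟩ with ha_def
  set b : GL (Fin 2) (ZMod 3) := ⟨!![0, 1; 1, 0], !![0, 1; 1, 0], by decide, by decide⟩ with hb_def
  have ha : a ∈ Subgroup.closure ({a, b} : Set (GL (Fin 2) (ZMod 3))) := Subgroup.subset_closure (by simp)
  have hb : b ∈ Subgroup.closure ({a, b} : Set (GL (Fin 2) (ZMod 3))) := Subgroup.subset_closure (by simp)
  have key : ((⟨!![2, 0; 0, 2], !![2, 0; 0, 2], by decide, by decide⟩ : GL (Fin 2) (ZMod 3))) = a * b * a * b := by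
    rw [ha_def, hb_def]; decide
  rw [key]
  exact mul_mem (mul_mem (mul_mem ha hb) ha) hb

/-- −I ∈ G(e7) = ⟨g₁ = (0 5;3 0), g₂ = (5 0;3 2)⟩ ⊂ GL₂(𝔽₇) (word g₁g₂g₁g₂g₁g₂g₁g₂g₂g₂). -/
theorem negOne_mem_Ge7 :
    ((⟨!![6, 0; 0, 6], !![6, 0; 0, 6], by decide, by decide⟩ : GL (Fin 2) (ZMod 7))) ∈
      Subgroup.closure ({(⟨!![0, 5; 3, 0], !![0, 5; 3, 0], by decide, by decide⟩ : GL (Fin 2) (ZMod 7)), (⟨!![5, 0; 3, 2], !![3, 0; 6, 4], by decide, by decide⟩ : GL (Fin 2) (ZMod 7))} : Set (GL (Fin 2) (ZMod 7))) := by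
  set a : GL (Fin 2) (ZMod 7) := ⟨!![0, 5; 3, 0], !![0, 5; 3, 0], by decide, by decide⟩ with ha_def
  set b : GL (Fin 2) (ZMod 7) := ⟨!![5, 0; 3, 2], !![3, 0; 6, 4], by decide, by decide⟩ with hb_def
  have ha : a ∈ Subgroup.closure ({a, b} : Set (GL (Fin 2) (ZMod 7))) := Subgroup.subset_closure (by simp)
  have hb : b ∈ Subgroup.closure ({a, b} : Set (GL (Fin 2) (ZMod 7))) := Subgroup.subset_closure (by simp)
  have key : ((⟨!![6, 0; 0, 6], !![6, 0; 0, 6], by decide, by decide⟩ : GL (Fin 2) (ZMod 7))) =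
      a * b * a * b * a * b * a * b * b * b := by
    rw [ha_def, hb_def]; decide
  rw [key]
  exact mul_mem (mul_mem (mul_mem (mul_mem (mul_mem (mul_mem (mul_mem (mul_mem (mul_mem ha hb) ha) hb) ha) hb) ha) hb) hb) hb

end Summit.Langlands.Langlands.Theorems.QuinticX0105Split
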